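import Summits.CriticalPhenomena.SAWScalingLimit.Theorems.MassRatio.Negative.StarA

/-!
# Crux `MassRatio` (stmt-CriticalPhenomena-8550) — load-bearing hypotheses, part 20: `star_bounds_of_data`, `star_bounds`: at every full star `Σ⋆|F_{5/8}| − 2√3|T(v)| ≤ |S(v)| ≤ Σ⋆|F_{5/8}|` (VR from DCS Lemma 1)

Negative knowledge on the crux `MassRatio` (stmt-CriticalPhenomena-8550, route SAWDefectDecoherence r3),
written by the standing disprover (cdisprove, cycles 1–4). The series `MassRatio/Negative/*` does NOT
refute the crux (verdict: RESISTS — it is a pure exponent bet, predicted ratio `δ^{-25/48}` against the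
cut `δ^{-3/4}`); it proves which hypotheses of the crux are LOAD-BEARING (rows clause, `0 < ρ`,
`δ·mid(b_δ) → b`, exhaustion of compacts: each deleted ⇒ FALSE, by explicit admissible families in the
rectangle `D₀ = (-2,2)×(-1,1)` whose boundary mass at the target edge is starved EXACTLY by a bare
corridor), that the hypothesis frame is satisfiable (`massRatio_frame_nonvacuous`), and that the
`Nonempty`-SAW clause is implied by the others. Mechanism throughout: on a bare root-attached corridor
the self-avoiding walk is unique, so `|Z| = x_c^{length}` exactly, while a staircase walk certifies
`|Z(e₀)| ≥ x_c^{2 iK + 1}` at a mid-edge `e₀` of the compact `Kbox`; `x_c < 3/5` and Bernoulli finish.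
-/

namespace Summit.CriticalPhenomena.SAWScalingLimit.Theorems.MassRatio.Negative

open Literature.Probability.LatticeModels Literature.Probability.RandomPlanarGeometry.SAW
open Literature.Probability.RandomPlanarGeometry
open Summit.CriticalPhenomena.SAWScalingLimit.Theses.SAWDefectDecoherence

/-- **Star bounds from the vertex relation, abstract star data.** For a vertex `v ∈ Λ` of a simply
connected domain with boundary root `a`, whose `Λ`-star is `{p, q, r}` with half-displacements
`d₀ ω^t` (`ω = ζ²`, `|d₀| = 1/(2√3)`): with `F = F_{x_c,5/8}`, `S = Σ⋆ F`, `T = Σ⋆ conj(mid - c_v) F`,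
`Σ⋆ |F| - 2√3 |T| ≤ |S|` and `Σ⋆ |F| ≤ |S| + 2√3 |T|`. [folklore] -/
theorem star_bounds_of_data {Λ : Finset HexVertex} {a : Sym2 HexVertex} {v p q r : HexVertex}
    {d₀ : ℂ} (hΛ : hexDomainSimplyConnected Λ) (ha : a ∈ hexDomainBoundary Λ) (hv : v ∈ Λ)
    (hp : hexGraph.Adj v p) (hq : hexGraph.Adj v q) (hr : hexGraph.Adj v r)
    (hpq : p ≠ q) (hqr : q ≠ r) (hpr : p ≠ r)
    (hfilter : Λ.filter (fun t => hexGraph.Adj v t) = {p, q, r})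
    (hd : ‖d₀‖ * (2 * Real.sqrt 3) = 1)
    (hdp : hexMidpoint s(v, p) - hexCenter v = d₀)
    (hdq : hexMidpoint s(v, q) - hexCenter v = d₀ * triZeta ^ 2)
    (hdr : hexMidpoint s(v, r) - hexCenter v = d₀ * (triZeta ^ 2) ^ 2) :
    (∑ t ∈ Λ.filter (fun t => hexGraph.Adj v t),
        ‖hexParafermionicObservable Λ a hexCriticalFugacity (5 / 8) s(v, t)‖) -
      2 * Real.sqrt 3 * ‖∑ t ∈ Λ.filter (fun t => hexGraph.Adj v t),
        (starRingEnd ℂ) (hexMidpoint s(v, t) - hexCenter v) *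
          hexParafermionicObservable Λ a hexCriticalFugacity (5 / 8) s(v, t)‖ ≤
      ‖∑ t ∈ Λ.filter (fun t => hexGraph.Adj v t),
        hexParafermionicObservable Λ a hexCriticalFugacity (5 / 8) s(v, t)‖ ∧
    (∑ t ∈ Λ.filter (fun t => hexGraph.Adj v t),
        ‖hexParafermionicObservable Λ a hexCriticalFugacity (5 / 8) s(v, t)‖) ≤
      ‖∑ t ∈ Λ.filter (fun t => hexGraph.Adj v t),
        hexParafermionicObservable Λ a hexCriticalFugacity (5 / 8) s(v, t)‖ +
      2 * Real.sqrt 3 * ‖∑ t ∈ Λ.filter (fun t => hexGraph.Adj v t),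
        (starRingEnd ℂ) (hexMidpoint s(v, t) - hexCenter v) *
          hexParafermionicObservable Λ a hexCriticalFugacity (5 / 8) s(v, t)‖ := by
  set F := hexParafermionicObservable Λ a hexCriticalFugacity (5 / 8) with hF
  have hp' : p ∉ ({q, r} : Finset HexVertex) := by simp [hpq, hpr]
  have hq' : q ∉ ({r} : Finset HexVertex) := by simp [hqr]
  have hsum : ∀ g : HexVertex → ℂ, ∑ t ∈ Λ.filter (fun t => hexGraph.Adj v t), g t = g p + g q + g r := by
    intro g
    rw [hfilter, Finset.sum_insert hp', Finset.sum_insert hq', Finset.sum_singleton, add_assoc]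
  have hsumR : ∀ g : HexVertex → ℝ, ∑ t ∈ Λ.filter (fun t => hexGraph.Adj v t), g t = g p + g q + g r := by
    intro g
    rw [hfilter, Finset.sum_insert hp', Finset.sum_insert hq', Finset.sum_singleton, add_assoc]
  -- the vertex relation
  have hVR0 := DuminilCopinSmirnov2012_lemma1_holds Λ hΛ a ha v hv p q r hp hq hr hpq hqr hpr
  rw [← xc_def, hdp, hdq, hdr] at hVR0
  simp only [← hF] at hVR0
  have hd0 : d₀ ≠ 0 := by
    intro h; rw [h, norm_zero, zero_mul] at hd; exact zero_ne_one hd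
  have hVR : F s(v, p) + triZeta ^ 2 * F s(v, q) + (triZeta ^ 2) ^ 2 * F s(v, r) = 0 := by
    apply mul_left_cancel₀ hd0
    rw [mul_zero]
    linear_combination hVR0
  obtain ⟨hb1, hb2⟩ := star_norm_bounds one_add_zsq_add hVR
  -- the conjugate sum is `conj d₀ · T'`
  have hz3 := triZeta_cube
  have hz8 : (starRingEnd ℂ) ((triZeta ^ 2) ^ 2) = triZeta ^ 2 := by
    rw [map_pow, conj_zsq]
    linear_combination (triZeta ^ 5 - triZeta ^ 2) * hz3
  have hT : ∑ t ∈ Λ.filter (fun t => hexGraph.Adj v t),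
      (starRingEnd ℂ) (hexMidpoint s(v, t) - hexCenter v) * F s(v, t) =
      (starRingEnd ℂ) d₀ * (F s(v, p) + (triZeta ^ 2) ^ 2 * F s(v, q) + triZeta ^ 2 * F s(v, r)) := by
    rw [hsum, hdp, hdq, hdr, map_mul, map_mul, conj_zsq, hz8]
    ring
  have hTn : 2 * Real.sqrt 3 * ‖∑ t ∈ Λ.filter (fun t => hexGraph.Adj v t),
      (starRingEnd ℂ) (hexMidpoint s(v, t) - hexCenter v) * F s(v, t)‖ =
      ‖F s(v, p) + (triZeta ^ 2) ^ 2 * F s(v, q) + triZeta ^ 2 * F s(v, r)‖ := by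
    rw [hT, norm_mul, Complex.norm_conj]
    have := hd
    calc 2 * Real.sqrt 3 * (‖d₀‖ * ‖F s(v, p) + (triZeta ^ 2) ^ 2 * F s(v, q) + triZeta ^ 2 * F s(v, r)‖)
        = (‖d₀‖ * (2 * Real.sqrt 3)) *
            ‖F s(v, p) + (triZeta ^ 2) ^ 2 * F s(v, q) + triZeta ^ 2 * F s(v, r)‖ := by ring
      _ = _ := by rw [hd, one_mul]
  rw [hTn, hsumR, hsum]
  exact ⟨hb2, hb1⟩

/-- **Star bounds at a full interior star** (both vertex types): for `v ∈ Λ` with all three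
neighbours in `Λ`, `Σ⋆ |F| - 2√3 |T(v)| ≤ |S(v)| ≤ Σ⋆ |F|` where `S(v) = Σ_{t∼v} F({v,t})` is the
plain star sum of stub 1 and `T(v) = Σ_{t∼v} conj(mid{v,t} - c_v) F({v,t})` the conjugate defect of
`DefectDecoherence`. [folklore] -/
theorem star_bounds {Λ : Finset HexVertex} {a : Sym2 HexVertex} {v : HexVertex}
    (hΛ : hexDomainSimplyConnected Λ) (ha : a ∈ hexDomainBoundary Λ) (hv : v ∈ Λ)
    (hnb : ∀ t, hexGraph.Adj v t → t ∈ Λ) :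
    (∑ t ∈ Λ.filter (fun t => hexGraph.Adj v t),
        ‖hexParafermionicObservable Λ a hexCriticalFugacity (5 / 8) s(v, t)‖) -
      2 * Real.sqrt 3 * ‖∑ t ∈ Λ.filter (fun t => hexGraph.Adj v t),
        (starRingEnd ℂ) (hexMidpoint s(v, t) - hexCenter v) *
          hexParafermionicObservable Λ a hexCriticalFugacity (5 / 8) s(v, t)‖ ≤
      ‖∑ t ∈ Λ.filter (fun t => hexGraph.Adj v t),
        hexParafermionicObservable Λ a hexCriticalFugacity (5 / 8) s(v, t)‖ ∧
    (∑ t ∈ Λ.filter (fun t => hexGraph.Adj v t),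
        ‖hexParafermionicObservable Λ a hexCriticalFugacity (5 / 8) s(v, t)‖) ≤
      ‖∑ t ∈ Λ.filter (fun t => hexGraph.Adj v t),
        hexParafermionicObservable Λ a hexCriticalFugacity (5 / 8) s(v, t)‖ +
      2 * Real.sqrt 3 * ‖∑ t ∈ Λ.filter (fun t => hexGraph.Adj v t),
        (starRingEnd ℂ) (hexMidpoint s(v, t) - hexCenter v) *
          hexParafermionicObservable Λ a hexCriticalFugacity (5 / 8) s(v, t)‖ := by
  obtain ⟨y, i⟩ := v
  fin_cases i
  · obtain ⟨hp, hq, hr, hpq, hqr, hpr, hdp, hdq, hdr⟩ := star_up y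
    exact star_bounds_of_data hΛ ha hv hp hq hr hpq hqr hpr
      (filter_adj_up (hnb _ hp) (hnb _ hq) (hnb _ hr)) norm_d₀_mul hdp hdq hdr
  · obtain ⟨hp, hq, hr, hpq, hqr, hpr, hdp, hdq, hdr⟩ := star_down y
    have hd' : ‖-(1 + triZeta) / 6‖ * (2 * Real.sqrt 3) = 1 := by
      rw [neg_div, norm_neg]; exact norm_d₀_mul
    exact star_bounds_of_data hΛ ha hv hp hq hr hpq hqr hpr
      (filter_adj_down (hnb _ hp) (hnb _ hq) (hnb _ hr)) hd' hdp hdq hdr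

end Summit.CriticalPhenomena.SAWScalingLimit.Theorems.MassRatio.Negative
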